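import Summits.NavierStokesRegularity.NavierStokesRegularity.Theorems.LerayQuarterDissipationFiniteDissipationLiouvilleQuietCore
import Summits.NavierStokesRegularity.NavierStokesRegularity.Theorems.LerayQuarterDissipationFiniteDissipationLiouvilleCriticalElement
import Summits.NavierStokesRegularity.NavierStokesRegularity.Theorems.SqueezeCycleExtremalElementExistsRescale
import Mathlib.MeasureTheory.Group.LIntegral
import HarnessLib

/-!
# Crux `FiniteDissipationLiouville` (stmt-NavierStokesRegularity-22144): THE CRITICAL ELEMENT
# BLOWS UP AT EXACTLY ONE POINT

Theorems file of route `LerayQuarterDissipation` (seat ns-lqd-p2 g7; `--supports` the crux; the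
structural consequence of the quiet-core leaf anticipated by the line lead, g4 census: "one
quiet-dissipation slice ⇒ regular would make a K-critical element's singular set a single point").
Navier–Stokes regularity is NOT proved by anything here; no summit is.

Setting: `𝒟_{C,K}` = Type-I ancient mild fields (KNSS gauge, constant `C`) with the law
`∫ ‖∇w(s)‖² ≤ K/√(−s)`; "singular (at the apex)" = unbounded on every backward cylinder
`(−r², 0) × B(0, r)`. ns-lqd-p1's CRITICAL ELEMENT (`CriticalElement.exists_minimal_singular`,
p592183): if some `𝒟_{C,K}` has a singular member then there is a least `K_c` for which `𝒟_{C,K_c}`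
has one, and no `𝒟_{C,K'}`, `K' < K_c`, does.

* `isTypeIAncientMild_translate`, `law_translate` — the stratum is invariant under spatial
  translations `w ↦ w(·, x₁ + ·)`;
* `setLIntegral_ball_fderiv_translate_sq`, `setLIntegral_ball_fderiv_nsRescale_sq_center` — how ball
  dissipations move under translation and under the parabolic rescaling with a general centre;
* `not_singular_translate_of_minimal` — **a singular member `W` of `𝒟_{C,K_c}` with `K_c` MINIMAL is
  regular at every other final-time point: for `x₁ ≠ 0` the translate `W(·, x₁ + ·)` is bounded on
  some backward cylinder at the origin.** Proof: if `x₁` were singular too, zoom into `x₁`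
  (`v_λ(s,y) = λW(λ²s, x₁+λy)`, `λ → 0`): the zooms are singular members of `𝒟_{C,K_c}`, so a
  subsequence converges (KNSS compactness across members, `Compactness.seqLimit`) to a SINGULAR
  member `W'` (`persistent_singularity_seq`). But the ORIGINAL apex singularity of `W` carries, at
  every instant `τ`, core dissipation `> δ/√(−τ)` on `B(0, √(−τ))` with `δ = δ(C,K_c,1) > 0`
  (`QuietCore.coreDissipation_floor_of_singular`); in the zoomed frame this is a ball of dissipation
  `> δ/√(−s)` centred at distance `‖x₁‖/λ → ∞`, disjoint from any fixed `B(0,R)` for small `λ`, so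
  `∫_{B(0,R)} ‖∇v_λ(s)‖² ≤ (K_c − δ)/√(−s)`; Fatou on balls and exhaustion give `W' ∈ 𝒟_{C,K_c−δ}` —
  contradicting the minimality of `K_c`;
* `exists_criticalElement_singlePoint` — packaged with `exists_minimal_singular`: **if the crux fails
  for the constant `C` (some `𝒟_{C,K}` has a singular member), then there is a critical singular
  member whose final-time singular set is EXACTLY the apex `{0}`** — the minimal counterexample to
  `FiniteDissipationLiouville` is a one-point blow-up profile (cf. lead g4: every member has a finite
  singular set, `#S ≤ c(K⁺)³`).

References: Koch–Nadirashvili–Seregin–Šverák, Acta Math. 203 (2009) = arXiv:0709.3599, §4;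
Albritton–Barker, arXiv:1811.00502, Prop. 2.3; Kenig–Merle, Invent. Math. 166 (2006) (the
critical-element paradigm).
-/

noncomputable section

-- the summit and its single sub-problem share the name (CONVENTIONS §1), as in every Theorems file
set_option linter.dupNamespace false

namespace Summit.NavierStokesRegularity.NavierStokesRegularity.Theorems.FiniteDissipationLiouville.CriticalPoint

open MeasureTheory Set Filter Topology Metric Function
open Literature.Analysis Literature.Analysis.FluidPDE
open Summit.NavierStokesRegularity.NavierStokesRegularity.Theorems.FiniteDissipationLiouville
open Summit.NavierStokesRegularity.NavierStokesRegularity.Theorems (isTypeIAncientMild_zoom)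
open scoped ENNReal NNReal

/-! ### Translations -/

/-- **The class is invariant under spatial translations** (KNSS 2009, §1: symmetries of the
problem; the tree's `isTypeIAncientMild_zoom` with unit scale). [cite: KochNadirashviliSereginSverak2009, §1 p. 3 (arXiv:0709.3599)] -/
theorem isTypeIAncientMild_translate {C : ℝ}
    {w : ℝ → EuclideanSpace ℝ (Fin 3) → EuclideanSpace ℝ (Fin 3)} (hw : IsTypeIAncientMild C w)
    (x₁ : EuclideanSpace ℝ (Fin 3)) : IsTypeIAncientMild C (fun s y => w s (x₁ + y)) := by
  have h := isTypeIAncientMild_zoom hw one_pos x₁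
  have e : ((1 : ℝ) • stPull ((1 : ℝ) ^ 2) 1 0 x₁ w) = fun s y => w s (x₁ + y) := by
    funext s y
    simp [stPull]
  rwa [e] at h

/-- The gradient of a translate is the translate of the gradient. [folklore] -/
theorem fderiv_translate (w : ℝ → EuclideanSpace ℝ (Fin 3) → EuclideanSpace ℝ (Fin 3)) (s : ℝ)
    (x₁ y : EuclideanSpace ℝ (Fin 3)) :
    fderiv ℝ (fun z => w s (x₁ + z)) y = fderiv ℝ (w s) (x₁ + y) :=
  fderiv_comp_add_left x₁

/-- **The dissipation law is invariant under spatial translations** (Lebesgue measure is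
translation invariant). [folklore] -/
theorem law_translate {K : ℝ} {w : ℝ → EuclideanSpace ℝ (Fin 3) → EuclideanSpace ℝ (Fin 3)}
    (hlaw : ∀ s : ℝ, s < 0 → ∫⁻ x, ‖fderiv ℝ (w s) x‖ₑ ^ 2 ≤ ENNReal.ofReal (K / Real.sqrt (-s)))
    (x₁ : EuclideanSpace ℝ (Fin 3)) :
    ∀ s : ℝ, s < 0 →
      ∫⁻ y, ‖fderiv ℝ (fun z => w s (x₁ + z)) y‖ₑ ^ 2 ≤ ENNReal.ofReal (K / Real.sqrt (-s)) := by
  intro s hs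
  set G : EuclideanSpace ℝ (Fin 3) → ℝ≥0∞ := fun x => ‖fderiv ℝ (w s) x‖ₑ ^ 2 with hG
  have e : (fun y => ‖fderiv ℝ (fun z => w s (x₁ + z)) y‖ₑ ^ 2) = fun y => G (x₁ + y) := by
    funext y; rw [fderiv_translate]
  rw [e, lintegral_add_left_eq_self]
  exact hlaw s hs

/-- **Ball dissipation of a translate**: `∫_{B(z₀,ρ)} ‖∇w(s, x₁+·)‖² = ∫_{B(x₁+z₀,ρ)} ‖∇w(s)‖²`. [folklore] -/
theorem setLIntegral_ball_fderiv_translate_sq (w : ℝ → EuclideanSpace ℝ (Fin 3) → EuclideanSpace ℝ (Fin 3))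
    (s : ℝ) (x₁ z₀ : EuclideanSpace ℝ (Fin 3)) (ρ : ℝ) :
    ∫⁻ y in ball z₀ ρ, ‖fderiv ℝ (fun z => w s (x₁ + z)) y‖ₑ ^ 2 =
      ∫⁻ x in ball (x₁ + z₀) ρ, ‖fderiv ℝ (w s) x‖ₑ ^ 2 := by
  set G : EuclideanSpace ℝ (Fin 3) → ℝ≥0∞ :=
    (ball (x₁ + z₀) ρ).indicator fun x => ‖fderiv ℝ (w s) x‖ₑ ^ 2 with hG
  have e : (ball z₀ ρ).indicator (fun y => ‖fderiv ℝ (fun z => w s (x₁ + z)) y‖ₑ ^ 2) =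
      fun y => G (x₁ + y) := by
    funext y
    by_cases hy : y ∈ ball z₀ ρ
    · have hy' : x₁ + y ∈ ball (x₁ + z₀) ρ := by
        rw [mem_ball] at hy ⊢; rwa [dist_add_left]
      rw [indicator_of_mem hy, hG, indicator_of_mem hy', fderiv_translate]
    · have hy' : x₁ + y ∉ ball (x₁ + z₀) ρ := by
        rw [mem_ball] at hy ⊢; rwa [dist_add_left]
      rw [indicator_of_notMem hy, hG, indicator_of_notMem hy']
  rw [← lintegral_indicator measurableSet_ball, ← lintegral_indicator measurableSet_ball, e,
    lintegral_add_left_eq_self]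

/-- **Ball dissipation under the parabolic rescaling, general centre**:
`∫_{B(y₀,r)} ‖∇w_c(s)‖² = c ∫_{B(c y₀, c r)} ‖∇w(c²s)‖²`, `c > 0`. [cite: KochNadirashviliSereginSverak2009, §1 (1.2) (arXiv:0709.3599 p. 2)] -/
theorem setLIntegral_ball_fderiv_nsRescale_sq_center {c : ℝ} (hc : 0 < c)
    (u : ℝ → EuclideanSpace ℝ (Fin 3) → EuclideanSpace ℝ (Fin 3)) (s : ℝ)
    (y₀ : EuclideanSpace ℝ (Fin 3)) (r : ℝ) :
    ∫⁻ x in ball y₀ r, ‖fderiv ℝ (nsRescale c u s) x‖ₑ ^ 2 =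
      ENNReal.ofReal c * ∫⁻ y in ball (c • y₀) (c * r), ‖fderiv ℝ (u (c ^ 2 * s)) y‖ₑ ^ 2 := by
  have hc0 : c ≠ 0 := hc.ne'
  set G : EuclideanSpace ℝ (Fin 3) → ℝ≥0∞ :=
    (ball (c • y₀) (c * r)).indicator fun y => ‖fderiv ℝ (u (c ^ 2 * s)) y‖ₑ ^ 2 with hG
  have hmem : ∀ x, x ∈ ball y₀ r ↔ c • x ∈ ball (c • y₀) (c * r) := by
    intro x
    rw [mem_ball, mem_ball, dist_eq_norm, dist_eq_norm, ← smul_sub, norm_smul,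
      Real.norm_of_nonneg hc.le]
    exact ⟨fun h => mul_lt_mul_of_pos_left h hc, fun h => lt_of_mul_lt_mul_left h hc.le⟩
  have e1 : ∀ x, (ball y₀ r).indicator (fun x => ‖fderiv ℝ (nsRescale c u s) x‖ₑ ^ 2) x =
      ENNReal.ofReal (c ^ 4) * G (c • x + 0) := by
    intro x
    rw [add_zero]
    by_cases hx : x ∈ ball y₀ r
    · have hcx := (hmem x).1 hx
      rw [indicator_of_mem hx, hG, indicator_of_mem hcx, RecurrentReductionD.fderiv_nsRescale,
        enorm_smul, mul_pow]
      congr 1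
      rw [Real.enorm_eq_ofReal (by positivity), ← ENNReal.ofReal_pow (by positivity)]
      congr 1
      ring
    · have hcx : c • x ∉ ball (c • y₀) (c * r) := fun h => hx ((hmem x).2 h)
      rw [indicator_of_notMem hx, hG, indicator_of_notMem hcx, mul_zero]
  have hL : ∫⁻ x in ball y₀ r, ‖fderiv ℝ (nsRescale c u s) x‖ₑ ^ 2 =
      ∫⁻ x, (ball y₀ r).indicator (fun x => ‖fderiv ℝ (nsRescale c u s) x‖ₑ ^ 2) x :=
    (lintegral_indicator measurableSet_ball _).symm
  have hR : ∫⁻ y in ball (c • y₀) (c * r), ‖fderiv ℝ (u (c ^ 2 * s)) y‖ₑ ^ 2 = ∫⁻ y, G y := by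
    rw [hG]; exact (lintegral_indicator measurableSet_ball _).symm
  rw [hL, hR]
  simp_rw [e1]
  rw [lintegral_const_mul' _ _ ENNReal.ofReal_ne_top, PoincareBall.lintegral_comp_smul_add G hc0 0,
    ← mul_assoc, finrank_euclideanSpace, Fintype.card_fin]
  congr 1
  rw [← ENNReal.ofReal_mul (by positivity)]
  congr 1
  rw [abs_of_pos (by positivity)]
  field_simp

/-! ### The critical element blows up at one point only -/

/-- **A minimal singular member is regular at every other final-time point.** Let `W ∈ 𝒟_{C,K_c}`
be singular at the apex with `K_c` minimal (no `𝒟_{C,K'}`, `K' < K_c`, has a singular member). Then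
for every `x₁ ≠ 0` the translate `W(·, x₁ + ·)` is NOT singular at the apex, i.e. `W` is bounded on
some backward cylinder `(−r², 0) × B(x₁, r)`: otherwise the zooms into `x₁` converge (KNSS
compactness, persistence) to a singular member whose law has lost the core dissipation
`δ(C,K_c,1)/√(−s)` that the apex singularity of `W` carries away to spatial infinity
(`QuietCore.coreDissipation_floor_of_singular`, Fatou on balls, exhaustion) — a singular member of
`𝒟_{C,K_c−δ}`, contradicting minimality. [cite: KochNadirashviliSereginSverak2009, §4 (arXiv:0709.3599 p. 8)] [cite: AlbrittonBarker2019, Prop. 2.3] -/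
theorem not_singular_translate_of_minimal {C Kc : ℝ}
    {W : ℝ → EuclideanSpace ℝ (Fin 3) → EuclideanSpace ℝ (Fin 3)} (hW : IsTypeIAncientMild C W)
    (hlaw : ∀ s : ℝ, s < 0 → ∫⁻ x, ‖fderiv ℝ (W s) x‖ₑ ^ 2 ≤ ENNReal.ofReal (Kc / Real.sqrt (-s)))
    (hsing : ∀ r > 0, ∀ M : ℝ, ∃ t ∈ Ioo (-(r ^ 2)) (0 : ℝ),
      ∃ x ∈ ball (0 : EuclideanSpace ℝ (Fin 3)) r, M < ‖W t x‖)
    (hmin : ∀ K' : ℝ, K' < Kc → ∀ w : ℝ → EuclideanSpace ℝ (Fin 3) → EuclideanSpace ℝ (Fin 3),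
      IsTypeIAncientMild C w →
      (∀ s : ℝ, s < 0 → ∫⁻ x, ‖fderiv ℝ (w s) x‖ₑ ^ 2 ≤ ENNReal.ofReal (K' / Real.sqrt (-s))) →
      ¬ (∀ r > 0, ∀ M : ℝ, ∃ t ∈ Ioo (-(r ^ 2)) (0 : ℝ),
        ∃ x ∈ ball (0 : EuclideanSpace ℝ (Fin 3)) r, M < ‖w t x‖))
    {x₁ : EuclideanSpace ℝ (Fin 3)} (hx₁ : x₁ ≠ 0) :
    ¬ (∀ r > 0, ∀ M : ℝ, ∃ t ∈ Ioo (-(r ^ 2)) (0 : ℝ),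
      ∃ x ∈ ball (0 : EuclideanSpace ℝ (Fin 3)) r, M < ‖W t (x₁ + x)‖) := by
  intro hsing₁
  -- ## the translate and its zooms
  set W₁ : ℝ → EuclideanSpace ℝ (Fin 3) → EuclideanSpace ℝ (Fin 3) := fun s y => W s (x₁ + y) with hW₁
  have hW₁c : IsTypeIAncientMild C W₁ := isTypeIAncientMild_translate hW x₁
  have hW₁law : ∀ s : ℝ, s < 0 →
      ∫⁻ x, ‖fderiv ℝ (W₁ s) x‖ₑ ^ 2 ≤ ENNReal.ofReal (Kc / Real.sqrt (-s)) := law_translate hlaw x₁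
  have hW₁sing : ∀ r > 0, ∀ M : ℝ, ∃ t ∈ Ioo (-(r ^ 2)) (0 : ℝ),
      ∃ x ∈ ball (0 : EuclideanSpace ℝ (Fin 3)) r, M < ‖W₁ t x‖ := hsing₁
  -- the core dissipation floor of the apex singularity of `W` (similarity radius 1)
  obtain ⟨δ, hδ, hfloor⟩ := QuietCore.coreDissipation_floor_of_singular C Kc 1 one_pos
  have hfloorW := hfloor W hW hlaw hsing
  -- zoom factors `λ_k = 1/(k+1) → 0`
  set lam : ℕ → ℝ := fun k => 1 / ((k : ℝ) + 1) with hlam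
  have hlam_pos : ∀ k, 0 < lam k := fun k => by rw [hlam]; positivity
  have hlam_anti : ∀ {j k : ℕ}, j ≤ k → lam k ≤ lam j := fun {j k} hjk => by
    rw [hlam]; dsimp only
    have hjk' : (j : ℝ) ≤ k := by exact_mod_cast hjk
    exact one_div_le_one_div_of_le (by positivity) (by linarith)
  set v : ℕ → ℝ → EuclideanSpace ℝ (Fin 3) → EuclideanSpace ℝ (Fin 3) :=
    fun k => nsRescale (lam k) W₁ with hv
  have hvc : ∀ k, IsTypeIAncientMild C (v k) := fun k => isTypeIAncientMild_nsRescale hW₁c (hlam_pos k)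
  have hvlaw : ∀ k, ∀ s : ℝ, s < 0 →
      ∫⁻ x, ‖fderiv ℝ (v k s) x‖ₑ ^ 2 ≤ ENNReal.ofReal (Kc / Real.sqrt (-s)) :=
    fun k => RecurrentReductionD.dissipationLaw_nsRescale hW₁law (hlam_pos k)
  have hvsing : ∀ k, ∀ r > 0, ∀ M : ℝ, ∃ t ∈ Ioo (-(r ^ 2)) (0 : ℝ),
      ∃ x ∈ ball (0 : EuclideanSpace ℝ (Fin 3)) r, M < ‖v k t x‖ :=
    fun k => RecurrentReductionD.singularAtOrigin_nsRescale hW₁sing (hlam_pos k)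
  -- ## the far ball of dissipation carried by the apex singularity of `W`
  have hfar : ∀ k, ∀ s : ℝ, s < 0 →
      ENNReal.ofReal (δ / Real.sqrt (-s)) <
        ∫⁻ x in ball (-((lam k)⁻¹ • x₁)) (Real.sqrt (-s)), ‖fderiv ℝ (v k s) x‖ₑ ^ 2 := by
    intro k s hs
    have hl := hlam_pos k
    have hτ : lam k ^ 2 * s < 0 := mul_neg_of_pos_of_neg (by positivity) hs
    have hsq : Real.sqrt (-(lam k ^ 2 * s)) = lam k * Real.sqrt (-s) := by
      rw [show -(lam k ^ 2 * s) = lam k ^ 2 * (-s) by ring, Real.sqrt_mul' _ (neg_nonneg.2 hs.le),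
        Real.sqrt_sq hl.le]
    have hcenter : lam k • (-((lam k)⁻¹ • x₁)) = -x₁ := by
      rw [smul_neg, smul_smul, mul_inv_cancel₀ hl.ne', one_smul]
    rw [hv, setLIntegral_ball_fderiv_nsRescale_sq_center hl, hcenter, hW₁]
    rw [show (fun s y => W s (x₁ + y)) (lam k ^ 2 * s) = fun z => W (lam k ^ 2 * s) (x₁ + z) from rfl,
      setLIntegral_ball_fderiv_translate_sq, add_neg_cancel]
    have h1 := hfloorW (lam k ^ 2 * s) hτ
    rw [one_mul, hsq] at h1
    -- `ofReal(δ/√(−s)) = ofReal(λ) * ofReal(δ/√(−λ²s))`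
    have e : ENNReal.ofReal (δ / Real.sqrt (-s)) =
        ENNReal.ofReal (lam k) * ENNReal.ofReal (δ / (lam k * Real.sqrt (-s))) := by
      rw [← ENNReal.ofReal_mul hl.le]
      congr 1
      have hs' : 0 < Real.sqrt (-s) := Real.sqrt_pos.2 (neg_pos.2 hs)
      field_simp
    rw [e]
    have h0 : ENNReal.ofReal (lam k) ≠ 0 := by rwa [ne_eq, ENNReal.ofReal_eq_zero, not_le]
    have htop : ENNReal.ofReal (lam k) ≠ ⊤ := ENNReal.ofReal_ne_top
    gcongr
  -- ## compactness across members: the zoom limit `W'`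
  obtain ⟨ψ, hψ, W', hW', hunif, -, hgrad⟩ := Compactness.seqLimit hvc
  have hψt : Tendsto ψ atTop atTop := hψ.tendsto_atTop
  have hW'sing := Compactness.persistent_singularity_seq (w := fun j => v (ψ j))
    (fun j => hvc (ψ j)) (fun j => hvlaw (ψ j)) (fun j => hvsing (ψ j)) hW' hunif
  -- ## the law of the limit has constant `Kc − δ`
  have hW'law : ∀ s : ℝ, s < 0 →
      ∫⁻ x, ‖fderiv ℝ (W' s) x‖ₑ ^ 2 ≤ ENNReal.ofReal ((Kc - δ) / Real.sqrt (-s)) := by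
    intro s hs
    have hs' : 0 < Real.sqrt (-s) := Real.sqrt_pos.2 (neg_pos.2 hs)
    -- on every ball `B(0, R)`
    have hball : ∀ R : ℝ, 0 < R →
        ∫⁻ x in ball (0 : EuclideanSpace ℝ (Fin 3)) R, ‖fderiv ℝ (W' s) x‖ₑ ^ 2 ≤
          ENNReal.ofReal ((Kc - δ) / Real.sqrt (-s)) := by
      intro R hR
      refine QuietCore.setLIntegral_fderiv_sq_le_of_tendsto_of_eventually (hgrad s hs) ?_
      -- for large `j` the far ball is disjoint from `B(0,R)`
      obtain ⟨N, hN⟩ := exists_nat_gt ((R + Real.sqrt (-s)) / ‖x₁‖)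
      have hx₁pos : 0 < ‖x₁‖ := norm_pos_iff.2 hx₁
      filter_upwards [hψt.eventually_ge_atTop N] with j hj
      set k : ℕ := ψ j with hk
      have hl := hlam_pos k
      -- `λ_k ≤ ‖x₁‖/(R + √(−s))`
      have hlk : lam k * (R + Real.sqrt (-s)) ≤ ‖x₁‖ := by
        have h1 : lam k ≤ lam N := hlam_anti hj
        have h2 : lam N * (R + Real.sqrt (-s)) < ‖x₁‖ := by
          rw [hlam]; dsimp only
          rw [div_lt_iff₀ hx₁pos] at hN
          rw [one_div, inv_mul_lt_iff₀ (by positivity : (0 : ℝ) < (N : ℝ) + 1)]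
          nlinarith
        nlinarith [mul_le_mul_of_nonneg_right h1 (by positivity : (0 : ℝ) ≤ R + Real.sqrt (-s))]
      have hdisj : Disjoint (ball (0 : EuclideanSpace ℝ (Fin 3)) R)
          (ball (-((lam k)⁻¹ • x₁)) (Real.sqrt (-s))) := by
        rw [Set.disjoint_left]
        intro y hy hy'
        rw [mem_ball_zero_iff] at hy
        rw [mem_ball, dist_eq_norm, sub_neg_eq_add] at hy'
        have h1 : ‖(lam k)⁻¹ • x₁‖ ≤ ‖y + (lam k)⁻¹ • x₁‖ + ‖y‖ := by
          have := norm_sub_le (y + (lam k)⁻¹ • x₁) y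
          rwa [add_sub_cancel_left] at this
        rw [norm_smul, norm_inv, Real.norm_of_nonneg hl.le] at h1
        have h2 : (lam k)⁻¹ * ‖x₁‖ < Real.sqrt (-s) + R := by linarith
        rw [inv_mul_lt_iff₀ hl] at h2
        linarith
      -- split the law of `v k` at time `s`
      have hunion := lintegral_union measurableSet_ball hdisj
        (μ := (volume : Measure (EuclideanSpace ℝ (Fin 3)))) (f := fun x => ‖fderiv ℝ (v k s) x‖ₑ ^ 2)
      have htot : ∫⁻ x in ball (0 : EuclideanSpace ℝ (Fin 3)) R ∪ ball (-((lam k)⁻¹ • x₁)) (Real.sqrt (-s)),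
          ‖fderiv ℝ (v k s) x‖ₑ ^ 2 ≤ ENNReal.ofReal (Kc / Real.sqrt (-s)) :=
        (setLIntegral_le_lintegral _ _).trans (hvlaw k s hs)
      rw [hunion] at htot
      have hsum : (∫⁻ x in ball (0 : EuclideanSpace ℝ (Fin 3)) R, ‖fderiv ℝ (v k s) x‖ₑ ^ 2) +
          ENNReal.ofReal (δ / Real.sqrt (-s)) ≤ ENNReal.ofReal (Kc / Real.sqrt (-s)) :=
        (add_le_add le_rfl (hfar k s hs).le).trans htot
      have hsub := ENNReal.le_sub_of_add_le_right ENNReal.ofReal_ne_top hsum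
      rw [← ENNReal.ofReal_sub _ (by positivity)] at hsub
      rwa [sub_div]
    -- exhaustion by the balls `B(0, n+1)`
    have hdir : Directed (· ⊆ ·) fun n : ℕ => ball (0 : EuclideanSpace ℝ (Fin 3)) ((n : ℝ) + 1) := by
      refine Monotone.directed_le fun m n hmn => ball_subset_ball ?_
      have hmn' : (m : ℝ) ≤ n := by exact_mod_cast hmn
      linarith
    have hU : (⋃ n : ℕ, ball (0 : EuclideanSpace ℝ (Fin 3)) ((n : ℝ) + 1)) = univ := by
      apply eq_univ_of_forall
      intro x
      obtain ⟨n, hn⟩ := exists_nat_gt ‖x‖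
      exact mem_iUnion.2 ⟨n, mem_ball_zero_iff.2 (by linarith)⟩
    calc ∫⁻ x, ‖fderiv ℝ (W' s) x‖ₑ ^ 2
        = ∫⁻ x in ⋃ n : ℕ, ball (0 : EuclideanSpace ℝ (Fin 3)) ((n : ℝ) + 1), ‖fderiv ℝ (W' s) x‖ₑ ^ 2 := by
          rw [hU, setLIntegral_univ]
      _ = ⨆ n : ℕ, ∫⁻ x in ball (0 : EuclideanSpace ℝ (Fin 3)) ((n : ℝ) + 1), ‖fderiv ℝ (W' s) x‖ₑ ^ 2 :=
          setLIntegral_iUnion_of_directed _ hdir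
      _ ≤ ENNReal.ofReal ((Kc - δ) / Real.sqrt (-s)) := iSup_le fun n => hball _ (by positivity)
  -- ## contradiction with the minimality of `Kc`
  exact hmin (Kc - δ) (by linarith) W' hW' hW'law hW'sing

/-- **The critical element blows up at exactly one point.** If some stratum `𝒟_{C,K}` has a
member singular at the apex (i.e. the crux `FiniteDissipationLiouville` fails for the constant `C`
at the level `K`), then there are `K_c ≤ K` and a member `W ∈ 𝒟_{C,K_c}`, singular at the apex, with
`K_c` minimal, such that `W` is REGULAR at every other point of the final slice: for all `x₁ ≠ 0`,
`W` is bounded on some backward cylinder `(−r², 0) × B(x₁, r)` (`CriticalElement.exists_minimal_singular`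
+ `not_singular_translate_of_minimal`). [cite: KochNadirashviliSereginSverak2009, §4 (arXiv:0709.3599 p. 8)] -/
theorem exists_criticalElement_singlePoint {C K : ℝ}
    {u : ℝ → EuclideanSpace ℝ (Fin 3) → EuclideanSpace ℝ (Fin 3)} (hu : IsTypeIAncientMild C u)
    (hlaw : ∀ s : ℝ, s < 0 → ∫⁻ x, ‖fderiv ℝ (u s) x‖ₑ ^ 2 ≤ ENNReal.ofReal (K / Real.sqrt (-s)))
    (hsing : ∀ r > 0, ∀ M : ℝ, ∃ t ∈ Ioo (-(r ^ 2)) (0 : ℝ),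
      ∃ x ∈ ball (0 : EuclideanSpace ℝ (Fin 3)) r, M < ‖u t x‖) :
    ∃ Kc : ℝ, Kc ≤ K ∧ ∃ W : ℝ → EuclideanSpace ℝ (Fin 3) → EuclideanSpace ℝ (Fin 3),
      IsTypeIAncientMild C W ∧
      (∀ s : ℝ, s < 0 → ∫⁻ x, ‖fderiv ℝ (W s) x‖ₑ ^ 2 ≤ ENNReal.ofReal (Kc / Real.sqrt (-s))) ∧
      (∀ r > 0, ∀ M : ℝ, ∃ t ∈ Ioo (-(r ^ 2)) (0 : ℝ),
        ∃ x ∈ ball (0 : EuclideanSpace ℝ (Fin 3)) r, M < ‖W t x‖) ∧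
      (∀ K' : ℝ, K' < Kc → ∀ w : ℝ → EuclideanSpace ℝ (Fin 3) → EuclideanSpace ℝ (Fin 3),
        IsTypeIAncientMild C w →
        (∀ s : ℝ, s < 0 → ∫⁻ x, ‖fderiv ℝ (w s) x‖ₑ ^ 2 ≤ ENNReal.ofReal (K' / Real.sqrt (-s))) →
        ¬ (∀ r > 0, ∀ M : ℝ, ∃ t ∈ Ioo (-(r ^ 2)) (0 : ℝ),
          ∃ x ∈ ball (0 : EuclideanSpace ℝ (Fin 3)) r, M < ‖w t x‖)) ∧
      ∀ x₁ : EuclideanSpace ℝ (Fin 3), x₁ ≠ 0 →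
        ∃ r > 0, ∃ M : ℝ, ∀ t ∈ Ioo (-(r ^ 2)) (0 : ℝ),
          ∀ x ∈ ball (0 : EuclideanSpace ℝ (Fin 3)) r, ‖W t (x₁ + x)‖ ≤ M := by
  obtain ⟨Kc, hKc, ⟨W, hW, hWlaw, hWsing⟩, hmin⟩ := CriticalElement.exists_minimal_singular hu hlaw hsing
  refine ⟨Kc, hKc, W, hW, hWlaw, hWsing, hmin, fun x₁ hx₁ => ?_⟩
  have h := not_singular_translate_of_minimal hW hWlaw hWsing hmin hx₁
  push Not at h
  obtain ⟨r, hr, M, hM⟩ := h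
  exact ⟨r, hr, M, fun t ht x hx => hM t ht x hx⟩

end Summit.NavierStokesRegularity.NavierStokesRegularity.Theorems.FiniteDissipationLiouville.CriticalPoint

end
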